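import Literature.Algebra.Polynomial.CasasAlvero.Char443Digits
import Literature.Algebra.Polynomial.CasasAlvero.Char443DigitsHigh
import Literature.Algebra.Polynomial.CasasAlvero.Char443DigitsTop
import Literature.Algebra.Polynomial.CasasAlvero.Degree7Char443
import Literature.Algebra.Polynomial.CasasAlvero.Pentanomial
import Literature.Algebra.Polynomial.CasasAlvero.Degree6CandidatesPrime
import Literature.Algebra.Polynomial.CasasAlvero.FieldCorollaries
import Literature.Algebra.Polynomial.CasasAlvero.Degree5
import Literature.Algebra.Polynomial.CasasAlvero.Degree6
import Literature.Algebra.Polynomial.CasasAlvero.DigitReduction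
import HarnessLib

/-!
# Casas-Alvero degrees in characteristic 443: the classification away from the digit `8`

Over EVERY field `K` of characteristic `443` and for every degree `d` that is NOT of the form `8·443^k`:
`CA_d(K) ⟺ d = 0 ∨ d = a·443^k` with `1 ≤ a ≤ 7`.  The one digit left open is `a = 8`, for the following reason.  Every bad digit in this
tree is refuted by an explicit `𝔽_p`-rational sparse polynomial with `𝔽_p`-rational witnesses (which lives in every field of characteristic `p`), but the
EXHAUSTIVE search of the translated–scaled normal form `X^8 + a_6 X^6 + … + a_1 X` over `𝔽_443`, in two independent implementations (`cls/dfbundle/dfind.py 443:8`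
and `cls/dfb/dfind_b.py 443:8`; kit jobs j131970 (`dfind_b.py`) and j131684 (`dfind.py`)), returns NOTHING: there is no Casas-Alvero octic over `𝔽_443` all of whose Hasse-derivative witnesses lie in
`𝔽_443`.  Consequently `CA_8` cannot be refuted uniformly over all fields of characteristic `443` by this method (indeed the search says that `CA_8` holds over
the prime field `𝔽_443` itself — a computational statement NOT formalised here), and whether `CA_8` holds over the algebraic closure of `𝔽_443` (whether `443`
is a good prime of degree `8` in the sense of [CastryckLaterveerOunaies2012]) is not decided in this tree: the cell has kernel-checked certificate machinery
for the degrees `≤ 7` only.  (COMPUTED BUT NOT FORMALISED: two independent implementations of the cell's scenario method made generic in the degree — implementation A,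
`d8/certD.py`, kit job j132787 (types ≤ 4) with j132846 (types 5, 6): for every one of the `876` non-trivial witness-coincidence scenarios of degree `8` an explicit Nullstellensatz certificate
`r_i^k = Σ_j g_j E_j (mod 443)`, found by linear algebra and RE-VERIFIED by polynomial multiplication over `ℤ`; implementation B, `d8/implB_groebnerd.py` (sympy Gröbner
bases over `GF(443)`), kit job j132411: every scenario inconsistent — agree that `443` is a GOOD prime for degree `8`, i.e. that `CA_8` holds over every field of
characteristic `443` and the digit set of characteristic `443` is `{1, 2, 3, 4, 5, 6, 7, 8}`.  Nothing of this is kernel-checked: the theorem needs the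
degree-`8` analogue of `Degree7ScenariosClosed.lean` plus the certificate data as Lean files, which is left open here; until then this file carves the digit out.)  Nothing below depends on the outcome.
Ingredients: the digit reduction `CA_d ⇒ d = a·p^k ∧ CA_a` (`DigitReduction.lean`, any field); the positive digits `1, 2, 3, 4`
([GrafVonBothmerEtAl2007, Props. 2, 6]), `5` (`Degree5.lean`: `443` is not one of the nine bad primes of degree `5`), `6` (`443` is not among the `54`
candidate bad primes of degree `6` of `Degree6CandidatesPrime.lean`, so `CA_6` holds in characteristic `443` [CastryckLaterveerOunaies2012, Thm. 4]) and `7`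
(`Degree7Char443.lean`: `443` is a GOOD prime for degree `7` — the kernel-checked scenario certificates `holdsInDegree_seven_of_char_443`; the bad primes of
degree `7` were computed in [CastryckLaterveerOunaies2012, Thm. 4]); and a refutation of every digit `9 ≤ a ≤ 442` over every field of characteristic `443`:
`21, 61, 78, 105, 109, 119, 134, 140, 142, 153, 155, 158, 165, 169, 173, 174, 175, 192, 202, 205, 211, 213, 214, 217, 220, 231, 233, 238, 248, 258, 260, 263, 264, 276, 278, 284, 285, 292, 297, 301, 305, 306, 310, 311, 312, 314, 316, 318, 325, 326, 332, 333, 334, 339, 346, 347, 349, 350, 358, 359, 362, 371, 375, 379, 380, 383, 385, 387, 388, 396, 399, 400, 401, 405, 407, 410, 411, 415, 419, 422, 425, 426, 427, 435, 437, 438, 439, 442` by the binomial criterion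
(`m = 3, 4, 32, 38, 54, 48, 42, 61, 62, 8, 71, 13, 70, 32, 80, 16, 83, 21, 39, 57, 35, 63, 20, 7, 96, 20, 102, 5, 20, 5, 117, 43, 93, 91, 57, 16, 41, 13, 8, 109, 32, 133, 71, 102, 130, 57, 77, 35, 63, 55, 13, 141, 97, 17, 124, 70, 80, 42, 103, 92, 62, 43, 38, 23, 80, 27, 4, 54, 139, 32, 71, 92, 15, 59, 176, 46, 5, 59, 63, 3, 103, 158, 5, 210, 15, 117, 18, 2`); and the 346 remaining digits by the sparse `𝔽_443`-examples of `Char443Digits.lean`, `Char443DigitsHigh.lean` and `Char443DigitsTop.lean`.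
-/

noncomputable section

open Polynomial

set_option maxRecDepth 8192

namespace Literature.Algebra.Polynomial.CasasAlvero

section CharFourHundredFortyThreePartial

variable (K : Type*) [Field K] [CharP K 443]

/-- `CA_{6·443^k}` over every field of characteristic `443` (`CA_6` itself — the case `k = 0` — holds because `443` is not among the
`54` candidate bad primes of degree `6` of `Degree6CandidatesPrime.lean`, `holdsInDegree_six_of_not_mem`, i.e. `443` is a GOOD prime for degree `6`
[cite: CastryckLaterveerOunaies2012, Thm. 4]). [cite: GrafVonBothmerEtAl2007, Prop. 6] -/
theorem holdsInDegree_six_mul_pow_of_char_443' (k : ℕ) : HoldsInDegree K (6 * 443 ^ k) := by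
  haveI : Fact (Nat.Prime 443) := ⟨by norm_num⟩
  exact holdsInDegree_mul_prime_pow_field K 443 (holdsInDegree_six_of_not_mem (K := AlgebraicClosure K) 443 (by decide)) k

set_option maxHeartbeats 4000000 in
/-- every digit `9 ≤ a < 443` other than `8` fails: `¬ CA_a` over every field of characteristic `443` — the bad-prime computations of
[cite: CastryckLaterveerOunaies2012, Thm. 4] (degrees `≤ 7`) extended to these digits by explicit `𝔽_443`-rational examples and the
binomial criterion (the digit `8` has no `𝔽_443`-rational-witness example and is not treated). [cite: GrafVonBothmerEtAl2007, Prop. 6] -/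
theorem not_holdsInDegree_digit_of_char_fourHundredFortyThree' {a : ℕ} (hlo : 9 ≤ a) (hap : a < 443) (h8 : a ≠ 8) : ¬ HoldsInDegree K a := by
  haveI : Fact (Nat.Prime 443) := ⟨by norm_num⟩
  interval_cases a
  · exact not_holdsInDegree_nine_of_char_443 K
  · exact not_holdsInDegree_ten_of_char_443 K
  · exact not_holdsInDegree_eleven_of_char_443 K
  · exact not_holdsInDegree_twelve_of_char_443 K
  · exact not_holdsInDegree_thirteen_of_char_443 K
  · exact not_holdsInDegree_fourteen_of_char_443 K
  · exact not_holdsInDegree_fifteen_of_char_443 K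
  · exact not_holdsInDegree_sixteen_of_char_443 K
  · exact not_holdsInDegree_seventeen_of_char_443 K
  · exact not_holdsInDegree_eighteen_of_char_443 K
  · exact not_holdsInDegree_nineteen_of_char_443 K
  · exact not_holdsInDegree_twenty_of_char_443 K
  · exact not_holdsInDegree_of_choose_modEq_one K 443 (d := 21) (m := 3) (by norm_num) (by norm_num) (by decide)
  · exact not_holdsInDegree_twentyTwo_of_char_443 K
  · exact not_holdsInDegree_twentyThree_of_char_443 K
  · exact not_holdsInDegree_twentyFour_of_char_443 K
  · exact not_holdsInDegree_twentyFive_of_char_443 K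
  · exact not_holdsInDegree_twentySix_of_char_443 K
  · exact not_holdsInDegree_twentySeven_of_char_443 K
  · exact not_holdsInDegree_twentyEight_of_char_443 K
  · exact not_holdsInDegree_twentyNine_of_char_443 K
  · exact not_holdsInDegree_thirty_of_char_443 K
  · exact not_holdsInDegree_thirtyOne_of_char_443 K
  · exact not_holdsInDegree_thirtyTwo_of_char_443 K
  · exact not_holdsInDegree_thirtyThree_of_char_443 K
  · exact not_holdsInDegree_thirtyFour_of_char_443 K
  · exact not_holdsInDegree_thirtyFive_of_char_443 K
  · exact not_holdsInDegree_thirtySix_of_char_443 K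
  · exact not_holdsInDegree_thirtySeven_of_char_443 K
  · exact not_holdsInDegree_thirtyEight_of_char_443 K
  · exact not_holdsInDegree_thirtyNine_of_char_443 K
  · exact not_holdsInDegree_forty_of_char_443 K
  · exact not_holdsInDegree_fortyOne_of_char_443 K
  · exact not_holdsInDegree_fortyTwo_of_char_443 K
  · exact not_holdsInDegree_fortyThree_of_char_443 K
  · exact not_holdsInDegree_fortyFour_of_char_443 K
  · exact not_holdsInDegree_fortyFive_of_char_443 K
  · exact not_holdsInDegree_fortySix_of_char_443 K
  · exact not_holdsInDegree_fortySeven_of_char_443 K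
  · exact not_holdsInDegree_fortyEight_of_char_443 K
  · exact not_holdsInDegree_fortyNine_of_char_443 K
  · exact not_holdsInDegree_fifty_of_char_443 K
  · exact not_holdsInDegree_fiftyOne_of_char_443 K
  · exact not_holdsInDegree_fiftyTwo_of_char_443 K
  · exact not_holdsInDegree_fiftyThree_of_char_443 K
  · exact not_holdsInDegree_fiftyFour_of_char_443 K
  · exact not_holdsInDegree_fiftyFive_of_char_443 K
  · exact not_holdsInDegree_fiftySix_of_char_443 K
  · exact not_holdsInDegree_fiftySeven_of_char_443 K
  · exact not_holdsInDegree_fiftyEight_of_char_443 K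
  · exact not_holdsInDegree_fiftyNine_of_char_443 K
  · exact not_holdsInDegree_sixty_of_char_443 K
  · exact not_holdsInDegree_of_choose_modEq_one K 443 (d := 61) (m := 4) (by norm_num) (by norm_num) (by decide)
  · exact not_holdsInDegree_sixtyTwo_of_char_443 K
  · exact not_holdsInDegree_sixtyThree_of_char_443 K
  · exact not_holdsInDegree_sixtyFour_of_char_443 K
  · exact not_holdsInDegree_sixtyFive_of_char_443 K
  · exact not_holdsInDegree_sixtySix_of_char_443 K
  · exact not_holdsInDegree_sixtySeven_of_char_443 K
  · exact not_holdsInDegree_sixtyEight_of_char_443 K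
  · exact not_holdsInDegree_sixtyNine_of_char_443 K
  · exact not_holdsInDegree_seventy_of_char_443 K
  · exact not_holdsInDegree_seventyOne_of_char_443 K
  · exact not_holdsInDegree_seventyTwo_of_char_443 K
  · exact not_holdsInDegree_seventyThree_of_char_443 K
  · exact not_holdsInDegree_seventyFour_of_char_443 K
  · exact not_holdsInDegree_seventyFive_of_char_443 K
  · exact not_holdsInDegree_seventySix_of_char_443 K
  · exact not_holdsInDegree_seventySeven_of_char_443 K
  · exact not_holdsInDegree_of_choose_modEq_one K 443 (d := 78) (m := 32) (by norm_num) (by norm_num) (by decide)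
  · exact not_holdsInDegree_seventyNine_of_char_443 K
  · exact not_holdsInDegree_eighty_of_char_443 K
  · exact not_holdsInDegree_eightyOne_of_char_443 K
  · exact not_holdsInDegree_eightyTwo_of_char_443 K
  · exact not_holdsInDegree_eightyThree_of_char_443 K
  · exact not_holdsInDegree_eightyFour_of_char_443 K
  · exact not_holdsInDegree_eightyFive_of_char_443 K
  · exact not_holdsInDegree_eightySix_of_char_443 K
  · exact not_holdsInDegree_eightySeven_of_char_443 K
  · exact not_holdsInDegree_eightyEight_of_char_443 K
  · exact not_holdsInDegree_eightyNine_of_char_443 K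
  · exact not_holdsInDegree_ninety_of_char_443 K
  · exact not_holdsInDegree_ninetyOne_of_char_443 K
  · exact not_holdsInDegree_ninetyTwo_of_char_443 K
  · exact not_holdsInDegree_ninetyThree_of_char_443 K
  · exact not_holdsInDegree_ninetyFour_of_char_443 K
  · exact not_holdsInDegree_ninetyFive_of_char_443 K
  · exact not_holdsInDegree_ninetySix_of_char_443 K
  · exact not_holdsInDegree_ninetySeven_of_char_443 K
  · exact not_holdsInDegree_ninetyEight_of_char_443 K
  · exact not_holdsInDegree_ninetyNine_of_char_443 K
  · exact not_holdsInDegree_oneHundred_of_char_443 K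
  · exact not_holdsInDegree_oneHundredOne_of_char_443 K
  · exact not_holdsInDegree_oneHundredTwo_of_char_443 K
  · exact not_holdsInDegree_oneHundredThree_of_char_443 K
  · exact not_holdsInDegree_oneHundredFour_of_char_443 K
  · exact not_holdsInDegree_of_choose_modEq_one K 443 (d := 105) (m := 38) (by norm_num) (by norm_num) (by decide)
  · exact not_holdsInDegree_oneHundredSix_of_char_443 K
  · exact not_holdsInDegree_oneHundredSeven_of_char_443 K
  · exact not_holdsInDegree_oneHundredEight_of_char_443 K
  · exact not_holdsInDegree_of_choose_modEq_one K 443 (d := 109) (m := 54) (by norm_num) (by norm_num) (by decide)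
  · exact not_holdsInDegree_oneHundredTen_of_char_443 K
  · exact not_holdsInDegree_oneHundredEleven_of_char_443 K
  · exact not_holdsInDegree_oneHundredTwelve_of_char_443 K
  · exact not_holdsInDegree_oneHundredThirteen_of_char_443 K
  · exact not_holdsInDegree_oneHundredFourteen_of_char_443 K
  · exact not_holdsInDegree_oneHundredFifteen_of_char_443 K
  · exact not_holdsInDegree_oneHundredSixteen_of_char_443 K
  · exact not_holdsInDegree_oneHundredSeventeen_of_char_443 K
  · exact not_holdsInDegree_oneHundredEighteen_of_char_443 K
  · exact not_holdsInDegree_of_choose_modEq_one K 443 (d := 119) (m := 48) (by norm_num) (by norm_num) (by decide)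
  · exact not_holdsInDegree_oneHundredTwenty_of_char_443 K
  · exact not_holdsInDegree_oneHundredTwentyOne_of_char_443 K
  · exact not_holdsInDegree_oneHundredTwentyTwo_of_char_443 K
  · exact not_holdsInDegree_oneHundredTwentyThree_of_char_443 K
  · exact not_holdsInDegree_oneHundredTwentyFour_of_char_443 K
  · exact not_holdsInDegree_oneHundredTwentyFive_of_char_443 K
  · exact not_holdsInDegree_oneHundredTwentySix_of_char_443 K
  · exact not_holdsInDegree_oneHundredTwentySeven_of_char_443 K
  · exact not_holdsInDegree_oneHundredTwentyEight_of_char_443 K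
  · exact not_holdsInDegree_oneHundredTwentyNine_of_char_443 K
  · exact not_holdsInDegree_oneHundredThirty_of_char_443 K
  · exact not_holdsInDegree_oneHundredThirtyOne_of_char_443 K
  · exact not_holdsInDegree_oneHundredThirtyTwo_of_char_443 K
  · exact not_holdsInDegree_oneHundredThirtyThree_of_char_443 K
  · exact not_holdsInDegree_of_choose_modEq_one K 443 (d := 134) (m := 42) (by norm_num) (by norm_num) (by decide)
  · exact not_holdsInDegree_oneHundredThirtyFive_of_char_443 K
  · exact not_holdsInDegree_oneHundredThirtySix_of_char_443 K
  · exact not_holdsInDegree_oneHundredThirtySeven_of_char_443 K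
  · exact not_holdsInDegree_oneHundredThirtyEight_of_char_443 K
  · exact not_holdsInDegree_oneHundredThirtyNine_of_char_443 K
  · exact not_holdsInDegree_of_choose_modEq_one K 443 (d := 140) (m := 61) (by norm_num) (by norm_num) (by decide)
  · exact not_holdsInDegree_oneHundredFortyOne_of_char_443 K
  · exact not_holdsInDegree_of_choose_modEq_one K 443 (d := 142) (m := 62) (by norm_num) (by norm_num) (by decide)
  · exact not_holdsInDegree_oneHundredFortyThree_of_char_443 K
  · exact not_holdsInDegree_oneHundredFortyFour_of_char_443 K
  · exact not_holdsInDegree_oneHundredFortyFive_of_char_443 K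
  · exact not_holdsInDegree_oneHundredFortySix_of_char_443 K
  · exact not_holdsInDegree_oneHundredFortySeven_of_char_443 K
  · exact not_holdsInDegree_oneHundredFortyEight_of_char_443 K
  · exact not_holdsInDegree_oneHundredFortyNine_of_char_443 K
  · exact not_holdsInDegree_oneHundredFifty_of_char_443 K
  · exact not_holdsInDegree_oneHundredFiftyOne_of_char_443 K
  · exact not_holdsInDegree_oneHundredFiftyTwo_of_char_443 K
  · exact not_holdsInDegree_of_choose_modEq_one K 443 (d := 153) (m := 8) (by norm_num) (by norm_num) (by decide)
  · exact not_holdsInDegree_oneHundredFiftyFour_of_char_443 K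
  · exact not_holdsInDegree_of_choose_modEq_one K 443 (d := 155) (m := 71) (by norm_num) (by norm_num) (by decide)
  · exact not_holdsInDegree_oneHundredFiftySix_of_char_443 K
  · exact not_holdsInDegree_oneHundredFiftySeven_of_char_443 K
  · exact not_holdsInDegree_of_choose_modEq_one K 443 (d := 158) (m := 13) (by norm_num) (by norm_num) (by decide)
  · exact not_holdsInDegree_oneHundredFiftyNine_of_char_443 K
  · exact not_holdsInDegree_oneHundredSixty_of_char_443 K
  · exact not_holdsInDegree_oneHundredSixtyOne_of_char_443 K
  · exact not_holdsInDegree_oneHundredSixtyTwo_of_char_443 K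
  · exact not_holdsInDegree_oneHundredSixtyThree_of_char_443 K
  · exact not_holdsInDegree_oneHundredSixtyFour_of_char_443 K
  · exact not_holdsInDegree_of_choose_modEq_one K 443 (d := 165) (m := 70) (by norm_num) (by norm_num) (by decide)
  · exact not_holdsInDegree_oneHundredSixtySix_of_char_443 K
  · exact not_holdsInDegree_oneHundredSixtySeven_of_char_443 K
  · exact not_holdsInDegree_oneHundredSixtyEight_of_char_443 K
  · exact not_holdsInDegree_of_choose_modEq_one K 443 (d := 169) (m := 32) (by norm_num) (by norm_num) (by decide)
  · exact not_holdsInDegree_oneHundredSeventy_of_char_443 K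
  · exact not_holdsInDegree_oneHundredSeventyOne_of_char_443 K
  · exact not_holdsInDegree_oneHundredSeventyTwo_of_char_443 K
  · exact not_holdsInDegree_of_choose_modEq_one K 443 (d := 173) (m := 80) (by norm_num) (by norm_num) (by decide)
  · exact not_holdsInDegree_of_choose_modEq_one K 443 (d := 174) (m := 16) (by norm_num) (by norm_num) (by decide)
  · exact not_holdsInDegree_of_choose_modEq_one K 443 (d := 175) (m := 83) (by norm_num) (by norm_num) (by decide)
  · exact not_holdsInDegree_oneHundredSeventySix_of_char_443 K
  · exact not_holdsInDegree_oneHundredSeventySeven_of_char_443 K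
  · exact not_holdsInDegree_oneHundredSeventyEight_of_char_443 K
  · exact not_holdsInDegree_oneHundredSeventyNine_of_char_443 K
  · exact not_holdsInDegree_oneHundredEighty_of_char_443 K
  · exact not_holdsInDegree_oneHundredEightyOne_of_char_443 K
  · exact not_holdsInDegree_oneHundredEightyTwo_of_char_443 K
  · exact not_holdsInDegree_oneHundredEightyThree_of_char_443 K
  · exact not_holdsInDegree_oneHundredEightyFour_of_char_443 K
  · exact not_holdsInDegree_oneHundredEightyFive_of_char_443 K
  · exact not_holdsInDegree_oneHundredEightySix_of_char_443 K
  · exact not_holdsInDegree_oneHundredEightySeven_of_char_443 K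
  · exact not_holdsInDegree_oneHundredEightyEight_of_char_443 K
  · exact not_holdsInDegree_oneHundredEightyNine_of_char_443 K
  · exact not_holdsInDegree_oneHundredNinety_of_char_443 K
  · exact not_holdsInDegree_oneHundredNinetyOne_of_char_443 K
  · exact not_holdsInDegree_of_choose_modEq_one K 443 (d := 192) (m := 21) (by norm_num) (by norm_num) (by decide)
  · exact not_holdsInDegree_oneHundredNinetyThree_of_char_443 K
  · exact not_holdsInDegree_oneHundredNinetyFour_of_char_443 K
  · exact not_holdsInDegree_oneHundredNinetyFive_of_char_443 K
  · exact not_holdsInDegree_oneHundredNinetySix_of_char_443 K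
  · exact not_holdsInDegree_oneHundredNinetySeven_of_char_443 K
  · exact not_holdsInDegree_oneHundredNinetyEight_of_char_443 K
  · exact not_holdsInDegree_oneHundredNinetyNine_of_char_443 K
  · exact not_holdsInDegree_twoHundred_of_char_443 K
  · exact not_holdsInDegree_twoHundredOne_of_char_443 K
  · exact not_holdsInDegree_of_choose_modEq_one K 443 (d := 202) (m := 39) (by norm_num) (by norm_num) (by decide)
  · exact not_holdsInDegree_twoHundredThree_of_char_443 K
  · exact not_holdsInDegree_twoHundredFour_of_char_443 K
  · exact not_holdsInDegree_of_choose_modEq_one K 443 (d := 205) (m := 57) (by norm_num) (by norm_num) (by decide)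
  · exact not_holdsInDegree_twoHundredSix_of_char_443 K
  · exact not_holdsInDegree_twoHundredSeven_of_char_443 K
  · exact not_holdsInDegree_twoHundredEight_of_char_443 K
  · exact not_holdsInDegree_twoHundredNine_of_char_443 K
  · exact not_holdsInDegree_twoHundredTen_of_char_443 K
  · exact not_holdsInDegree_of_choose_modEq_one K 443 (d := 211) (m := 35) (by norm_num) (by norm_num) (by decide)
  · exact not_holdsInDegree_twoHundredTwelve_of_char_443 K
  · exact not_holdsInDegree_of_choose_modEq_one K 443 (d := 213) (m := 63) (by norm_num) (by norm_num) (by decide)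
  · exact not_holdsInDegree_of_choose_modEq_one K 443 (d := 214) (m := 20) (by norm_num) (by norm_num) (by decide)
  · exact not_holdsInDegree_twoHundredFifteen_of_char_443 K
  · exact not_holdsInDegree_twoHundredSixteen_of_char_443 K
  · exact not_holdsInDegree_of_choose_modEq_one K 443 (d := 217) (m := 7) (by norm_num) (by norm_num) (by decide)
  · exact not_holdsInDegree_twoHundredEighteen_of_char_443 K
  · exact not_holdsInDegree_twoHundredNineteen_of_char_443 K
  · exact not_holdsInDegree_of_choose_modEq_one K 443 (d := 220) (m := 96) (by norm_num) (by norm_num) (by decide)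
  · exact not_holdsInDegree_twoHundredTwentyOne_of_char_443 K
  · exact not_holdsInDegree_twoHundredTwentyTwo_of_char_443 K
  · exact not_holdsInDegree_twoHundredTwentyThree_of_char_443 K
  · exact not_holdsInDegree_twoHundredTwentyFour_of_char_443 K
  · exact not_holdsInDegree_twoHundredTwentyFive_of_char_443 K
  · exact not_holdsInDegree_twoHundredTwentySix_of_char_443 K
  · exact not_holdsInDegree_twoHundredTwentySeven_of_char_443 K
  · exact not_holdsInDegree_twoHundredTwentyEight_of_char_443 K
  · exact not_holdsInDegree_twoHundredTwentyNine_of_char_443 K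
  · exact not_holdsInDegree_twoHundredThirty_of_char_443 K
  · exact not_holdsInDegree_of_choose_modEq_one K 443 (d := 231) (m := 20) (by norm_num) (by norm_num) (by decide)
  · exact not_holdsInDegree_twoHundredThirtyTwo_of_char_443 K
  · exact not_holdsInDegree_of_choose_modEq_one K 443 (d := 233) (m := 102) (by norm_num) (by norm_num) (by decide)
  · exact not_holdsInDegree_twoHundredThirtyFour_of_char_443 K
  · exact not_holdsInDegree_twoHundredThirtyFive_of_char_443 K
  · exact not_holdsInDegree_twoHundredThirtySix_of_char_443 K
  · exact not_holdsInDegree_twoHundredThirtySeven_of_char_443 K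
  · exact not_holdsInDegree_of_choose_modEq_one K 443 (d := 238) (m := 5) (by norm_num) (by norm_num) (by decide)
  · exact not_holdsInDegree_twoHundredThirtyNine_of_char_443 K
  · exact not_holdsInDegree_twoHundredForty_of_char_443 K
  · exact not_holdsInDegree_twoHundredFortyOne_of_char_443 K
  · exact not_holdsInDegree_twoHundredFortyTwo_of_char_443 K
  · exact not_holdsInDegree_twoHundredFortyThree_of_char_443 K
  · exact not_holdsInDegree_twoHundredFortyFour_of_char_443 K
  · exact not_holdsInDegree_twoHundredFortyFive_of_char_443 K
  · exact not_holdsInDegree_twoHundredFortySix_of_char_443 K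
  · exact not_holdsInDegree_twoHundredFortySeven_of_char_443 K
  · exact not_holdsInDegree_of_choose_modEq_one K 443 (d := 248) (m := 20) (by norm_num) (by norm_num) (by decide)
  · exact not_holdsInDegree_twoHundredFortyNine_of_char_443 K
  · exact not_holdsInDegree_twoHundredFifty_of_char_443 K
  · exact not_holdsInDegree_twoHundredFiftyOne_of_char_443 K
  · exact not_holdsInDegree_twoHundredFiftyTwo_of_char_443 K
  · exact not_holdsInDegree_twoHundredFiftyThree_of_char_443 K
  · exact not_holdsInDegree_twoHundredFiftyFour_of_char_443 K
  · exact not_holdsInDegree_twoHundredFiftyFive_of_char_443 K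
  · exact not_holdsInDegree_twoHundredFiftySix_of_char_443 K
  · exact not_holdsInDegree_twoHundredFiftySeven_of_char_443 K
  · exact not_holdsInDegree_of_choose_modEq_one K 443 (d := 258) (m := 5) (by norm_num) (by norm_num) (by decide)
  · exact not_holdsInDegree_twoHundredFiftyNine_of_char_443 K
  · exact not_holdsInDegree_of_choose_modEq_one K 443 (d := 260) (m := 117) (by norm_num) (by norm_num) (by decide)
  · exact not_holdsInDegree_twoHundredSixtyOne_of_char_443 K
  · exact not_holdsInDegree_twoHundredSixtyTwo_of_char_443 K
  · exact not_holdsInDegree_of_choose_modEq_one K 443 (d := 263) (m := 43) (by norm_num) (by norm_num) (by decide)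
  · exact not_holdsInDegree_of_choose_modEq_one K 443 (d := 264) (m := 93) (by norm_num) (by norm_num) (by decide)
  · exact not_holdsInDegree_twoHundredSixtyFive_of_char_443 K
  · exact not_holdsInDegree_twoHundredSixtySix_of_char_443 K
  · exact not_holdsInDegree_twoHundredSixtySeven_of_char_443 K
  · exact not_holdsInDegree_twoHundredSixtyEight_of_char_443 K
  · exact not_holdsInDegree_twoHundredSixtyNine_of_char_443 K
  · exact not_holdsInDegree_twoHundredSeventy_of_char_443 K
  · exact not_holdsInDegree_twoHundredSeventyOne_of_char_443 K
  · exact not_holdsInDegree_twoHundredSeventyTwo_of_char_443 K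
  · exact not_holdsInDegree_twoHundredSeventyThree_of_char_443 K
  · exact not_holdsInDegree_twoHundredSeventyFour_of_char_443 K
  · exact not_holdsInDegree_twoHundredSeventyFive_of_char_443 K
  · exact not_holdsInDegree_of_choose_modEq_one K 443 (d := 276) (m := 91) (by norm_num) (by norm_num) (by decide)
  · exact not_holdsInDegree_twoHundredSeventySeven_of_char_443 K
  · exact not_holdsInDegree_of_choose_modEq_one K 443 (d := 278) (m := 57) (by norm_num) (by norm_num) (by decide)
  · exact not_holdsInDegree_twoHundredSeventyNine_of_char_443 K
  · exact not_holdsInDegree_twoHundredEighty_of_char_443 K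
  · exact not_holdsInDegree_twoHundredEightyOne_of_char_443 K
  · exact not_holdsInDegree_twoHundredEightyTwo_of_char_443 K
  · exact not_holdsInDegree_twoHundredEightyThree_of_char_443 K
  · exact not_holdsInDegree_of_choose_modEq_one K 443 (d := 284) (m := 16) (by norm_num) (by norm_num) (by decide)
  · exact not_holdsInDegree_of_choose_modEq_one K 443 (d := 285) (m := 41) (by norm_num) (by norm_num) (by decide)
  · exact not_holdsInDegree_twoHundredEightySix_of_char_443 K
  · exact not_holdsInDegree_twoHundredEightySeven_of_char_443 K
  · exact not_holdsInDegree_twoHundredEightyEight_of_char_443 K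
  · exact not_holdsInDegree_twoHundredEightyNine_of_char_443 K
  · exact not_holdsInDegree_twoHundredNinety_of_char_443 K
  · exact not_holdsInDegree_twoHundredNinetyOne_of_char_443 K
  · exact not_holdsInDegree_of_choose_modEq_one K 443 (d := 292) (m := 13) (by norm_num) (by norm_num) (by decide)
  · exact not_holdsInDegree_twoHundredNinetyThree_of_char_443 K
  · exact not_holdsInDegree_twoHundredNinetyFour_of_char_443 K
  · exact not_holdsInDegree_twoHundredNinetyFive_of_char_443 K
  · exact not_holdsInDegree_twoHundredNinetySix_of_char_443 K
  · exact not_holdsInDegree_of_choose_modEq_one K 443 (d := 297) (m := 8) (by norm_num) (by norm_num) (by decide)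
  · exact not_holdsInDegree_twoHundredNinetyEight_of_char_443 K
  · exact not_holdsInDegree_twoHundredNinetyNine_of_char_443 K
  · exact not_holdsInDegree_threeHundred_of_char_443 K
  · exact not_holdsInDegree_of_choose_modEq_one K 443 (d := 301) (m := 109) (by norm_num) (by norm_num) (by decide)
  · exact not_holdsInDegree_threeHundredTwo_of_char_443 K
  · exact not_holdsInDegree_threeHundredThree_of_char_443 K
  · exact not_holdsInDegree_threeHundredFour_of_char_443 K
  · exact not_holdsInDegree_of_choose_modEq_one K 443 (d := 305) (m := 32) (by norm_num) (by norm_num) (by decide)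
  · exact not_holdsInDegree_of_choose_modEq_one K 443 (d := 306) (m := 133) (by norm_num) (by norm_num) (by decide)
  · exact not_holdsInDegree_threeHundredSeven_of_char_443 K
  · exact not_holdsInDegree_threeHundredEight_of_char_443 K
  · exact not_holdsInDegree_threeHundredNine_of_char_443 K
  · exact not_holdsInDegree_of_choose_modEq_one K 443 (d := 310) (m := 71) (by norm_num) (by norm_num) (by decide)
  · exact not_holdsInDegree_of_choose_modEq_one K 443 (d := 311) (m := 102) (by norm_num) (by norm_num) (by decide)
  · exact not_holdsInDegree_of_choose_modEq_one K 443 (d := 312) (m := 130) (by norm_num) (by norm_num) (by decide)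
  · exact not_holdsInDegree_threeHundredThirteen_of_char_443 K
  · exact not_holdsInDegree_of_choose_modEq_one K 443 (d := 314) (m := 57) (by norm_num) (by norm_num) (by decide)
  · exact not_holdsInDegree_threeHundredFifteen_of_char_443 K
  · exact not_holdsInDegree_of_choose_modEq_one K 443 (d := 316) (m := 77) (by norm_num) (by norm_num) (by decide)
  · exact not_holdsInDegree_threeHundredSeventeen_of_char_443 K
  · exact not_holdsInDegree_of_choose_modEq_one K 443 (d := 318) (m := 35) (by norm_num) (by norm_num) (by decide)
  · exact not_holdsInDegree_threeHundredNineteen_of_char_443 K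
  · exact not_holdsInDegree_threeHundredTwenty_of_char_443 K
  · exact not_holdsInDegree_threeHundredTwentyOne_of_char_443 K
  · exact not_holdsInDegree_threeHundredTwentyTwo_of_char_443 K
  · exact not_holdsInDegree_threeHundredTwentyThree_of_char_443 K
  · exact not_holdsInDegree_threeHundredTwentyFour_of_char_443 K
  · exact not_holdsInDegree_of_choose_modEq_one K 443 (d := 325) (m := 63) (by norm_num) (by norm_num) (by decide)
  · exact not_holdsInDegree_of_choose_modEq_one K 443 (d := 326) (m := 55) (by norm_num) (by norm_num) (by decide)
  · exact not_holdsInDegree_threeHundredTwentySeven_of_char_443 K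
  · exact not_holdsInDegree_threeHundredTwentyEight_of_char_443 K
  · exact not_holdsInDegree_threeHundredTwentyNine_of_char_443 K
  · exact not_holdsInDegree_threeHundredThirty_of_char_443 K
  · exact not_holdsInDegree_threeHundredThirtyOne_of_char_443 K
  · exact not_holdsInDegree_of_choose_modEq_one K 443 (d := 332) (m := 13) (by norm_num) (by norm_num) (by decide)
  · exact not_holdsInDegree_of_choose_modEq_one K 443 (d := 333) (m := 141) (by norm_num) (by norm_num) (by decide)
  · exact not_holdsInDegree_of_choose_modEq_one K 443 (d := 334) (m := 97) (by norm_num) (by norm_num) (by decide)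
  · exact not_holdsInDegree_threeHundredThirtyFive_of_char_443 K
  · exact not_holdsInDegree_threeHundredThirtySix_of_char_443 K
  · exact not_holdsInDegree_threeHundredThirtySeven_of_char_443 K
  · exact not_holdsInDegree_threeHundredThirtyEight_of_char_443 K
  · exact not_holdsInDegree_of_choose_modEq_one K 443 (d := 339) (m := 17) (by norm_num) (by norm_num) (by decide)
  · exact not_holdsInDegree_threeHundredForty_of_char_443 K
  · exact not_holdsInDegree_threeHundredFortyOne_of_char_443 K
  · exact not_holdsInDegree_threeHundredFortyTwo_of_char_443 K
  · exact not_holdsInDegree_threeHundredFortyThree_of_char_443 K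
  · exact not_holdsInDegree_threeHundredFortyFour_of_char_443 K
  · exact not_holdsInDegree_threeHundredFortyFive_of_char_443 K
  · exact not_holdsInDegree_of_choose_modEq_one K 443 (d := 346) (m := 124) (by norm_num) (by norm_num) (by decide)
  · exact not_holdsInDegree_of_choose_modEq_one K 443 (d := 347) (m := 70) (by norm_num) (by norm_num) (by decide)
  · exact not_holdsInDegree_threeHundredFortyEight_of_char_443 K
  · exact not_holdsInDegree_of_choose_modEq_one K 443 (d := 349) (m := 80) (by norm_num) (by norm_num) (by decide)
  · exact not_holdsInDegree_of_choose_modEq_one K 443 (d := 350) (m := 42) (by norm_num) (by norm_num) (by decide)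
  · exact not_holdsInDegree_threeHundredFiftyOne_of_char_443 K
  · exact not_holdsInDegree_threeHundredFiftyTwo_of_char_443 K
  · exact not_holdsInDegree_threeHundredFiftyThree_of_char_443 K
  · exact not_holdsInDegree_threeHundredFiftyFour_of_char_443 K
  · exact not_holdsInDegree_threeHundredFiftyFive_of_char_443 K
  · exact not_holdsInDegree_threeHundredFiftySix_of_char_443 K
  · exact not_holdsInDegree_threeHundredFiftySeven_of_char_443 K
  · exact not_holdsInDegree_of_choose_modEq_one K 443 (d := 358) (m := 103) (by norm_num) (by norm_num) (by decide)
  · exact not_holdsInDegree_of_choose_modEq_one K 443 (d := 359) (m := 92) (by norm_num) (by norm_num) (by decide)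
  · exact not_holdsInDegree_threeHundredSixty_of_char_443 K
  · exact not_holdsInDegree_threeHundredSixtyOne_of_char_443 K
  · exact not_holdsInDegree_of_choose_modEq_one K 443 (d := 362) (m := 62) (by norm_num) (by norm_num) (by decide)
  · exact not_holdsInDegree_threeHundredSixtyThree_of_char_443 K
  · exact not_holdsInDegree_threeHundredSixtyFour_of_char_443 K
  · exact not_holdsInDegree_threeHundredSixtyFive_of_char_443 K
  · exact not_holdsInDegree_threeHundredSixtySix_of_char_443 K
  · exact not_holdsInDegree_threeHundredSixtySeven_of_char_443 K
  · exact not_holdsInDegree_threeHundredSixtyEight_of_char_443 K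
  · exact not_holdsInDegree_threeHundredSixtyNine_of_char_443 K
  · exact not_holdsInDegree_threeHundredSeventy_of_char_443 K
  · exact not_holdsInDegree_of_choose_modEq_one K 443 (d := 371) (m := 43) (by norm_num) (by norm_num) (by decide)
  · exact not_holdsInDegree_threeHundredSeventyTwo_of_char_443 K
  · exact not_holdsInDegree_threeHundredSeventyThree_of_char_443 K
  · exact not_holdsInDegree_threeHundredSeventyFour_of_char_443 K
  · exact not_holdsInDegree_of_choose_modEq_one K 443 (d := 375) (m := 38) (by norm_num) (by norm_num) (by decide)
  · exact not_holdsInDegree_threeHundredSeventySix_of_char_443 K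
  · exact not_holdsInDegree_threeHundredSeventySeven_of_char_443 K
  · exact not_holdsInDegree_threeHundredSeventyEight_of_char_443 K
  · exact not_holdsInDegree_of_choose_modEq_one K 443 (d := 379) (m := 23) (by norm_num) (by norm_num) (by decide)
  · exact not_holdsInDegree_of_choose_modEq_one K 443 (d := 380) (m := 80) (by norm_num) (by norm_num) (by decide)
  · exact not_holdsInDegree_threeHundredEightyOne_of_char_443 K
  · exact not_holdsInDegree_threeHundredEightyTwo_of_char_443 K
  · exact not_holdsInDegree_of_choose_modEq_one K 443 (d := 383) (m := 27) (by norm_num) (by norm_num) (by decide)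
  · exact not_holdsInDegree_threeHundredEightyFour_of_char_443 K
  · exact not_holdsInDegree_of_choose_modEq_one K 443 (d := 385) (m := 4) (by norm_num) (by norm_num) (by decide)
  · exact not_holdsInDegree_threeHundredEightySix_of_char_443 K
  · exact not_holdsInDegree_of_choose_modEq_one K 443 (d := 387) (m := 54) (by norm_num) (by norm_num) (by decide)
  · exact not_holdsInDegree_of_choose_modEq_one K 443 (d := 388) (m := 139) (by norm_num) (by norm_num) (by decide)
  · exact not_holdsInDegree_threeHundredEightyNine_of_char_443 K
  · exact not_holdsInDegree_threeHundredNinety_of_char_443 K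
  · exact not_holdsInDegree_threeHundredNinetyOne_of_char_443 K
  · exact not_holdsInDegree_threeHundredNinetyTwo_of_char_443 K
  · exact not_holdsInDegree_threeHundredNinetyThree_of_char_443 K
  · exact not_holdsInDegree_threeHundredNinetyFour_of_char_443 K
  · exact not_holdsInDegree_threeHundredNinetyFive_of_char_443 K
  · exact not_holdsInDegree_of_choose_modEq_one K 443 (d := 396) (m := 32) (by norm_num) (by norm_num) (by decide)
  · exact not_holdsInDegree_threeHundredNinetySeven_of_char_443 K
  · exact not_holdsInDegree_threeHundredNinetyEight_of_char_443 K
  · exact not_holdsInDegree_of_choose_modEq_one K 443 (d := 399) (m := 71) (by norm_num) (by norm_num) (by decide)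
  · exact not_holdsInDegree_of_choose_modEq_one K 443 (d := 400) (m := 92) (by norm_num) (by norm_num) (by decide)
  · exact not_holdsInDegree_of_choose_modEq_one K 443 (d := 401) (m := 15) (by norm_num) (by norm_num) (by decide)
  · exact not_holdsInDegree_fourHundredTwo_of_char_443 K
  · exact not_holdsInDegree_fourHundredThree_of_char_443 K
  · exact not_holdsInDegree_fourHundredFour_of_char_443 K
  · exact not_holdsInDegree_of_choose_modEq_one K 443 (d := 405) (m := 59) (by norm_num) (by norm_num) (by decide)
  · exact not_holdsInDegree_fourHundredSix_of_char_443 K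
  · exact not_holdsInDegree_of_choose_modEq_one K 443 (d := 407) (m := 176) (by norm_num) (by norm_num) (by decide)
  · exact not_holdsInDegree_fourHundredEight_of_char_443 K
  · exact not_holdsInDegree_fourHundredNine_of_char_443 K
  · exact not_holdsInDegree_of_choose_modEq_one K 443 (d := 410) (m := 46) (by norm_num) (by norm_num) (by decide)
  · exact not_holdsInDegree_of_choose_modEq_one K 443 (d := 411) (m := 5) (by norm_num) (by norm_num) (by decide)
  · exact not_holdsInDegree_fourHundredTwelve_of_char_443 K
  · exact not_holdsInDegree_fourHundredThirteen_of_char_443 K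
  · exact not_holdsInDegree_fourHundredFourteen_of_char_443 K
  · exact not_holdsInDegree_of_choose_modEq_one K 443 (d := 415) (m := 59) (by norm_num) (by norm_num) (by decide)
  · exact not_holdsInDegree_fourHundredSixteen_of_char_443 K
  · exact not_holdsInDegree_fourHundredSeventeen_of_char_443 K
  · exact not_holdsInDegree_fourHundredEighteen_of_char_443 K
  · exact not_holdsInDegree_of_choose_modEq_one K 443 (d := 419) (m := 63) (by norm_num) (by norm_num) (by decide)
  · exact not_holdsInDegree_fourHundredTwenty_of_char_443 K
  · exact not_holdsInDegree_fourHundredTwentyOne_of_char_443 K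
  · exact not_holdsInDegree_of_choose_modEq_one K 443 (d := 422) (m := 3) (by norm_num) (by norm_num) (by decide)
  · exact not_holdsInDegree_fourHundredTwentyThree_of_char_443 K
  · exact not_holdsInDegree_fourHundredTwentyFour_of_char_443 K
  · exact not_holdsInDegree_of_choose_modEq_one K 443 (d := 425) (m := 103) (by norm_num) (by norm_num) (by decide)
  · exact not_holdsInDegree_of_choose_modEq_one K 443 (d := 426) (m := 158) (by norm_num) (by norm_num) (by decide)
  · exact not_holdsInDegree_of_choose_modEq_one K 443 (d := 427) (m := 5) (by norm_num) (by norm_num) (by decide)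
  · exact not_holdsInDegree_fourHundredTwentyEight_of_char_443 K
  · exact not_holdsInDegree_fourHundredTwentyNine_of_char_443 K
  · exact not_holdsInDegree_fourHundredThirty_of_char_443 K
  · exact not_holdsInDegree_fourHundredThirtyOne_of_char_443 K
  · exact not_holdsInDegree_fourHundredThirtyTwo_of_char_443 K
  · exact not_holdsInDegree_fourHundredThirtyThree_of_char_443 K
  · exact not_holdsInDegree_fourHundredThirtyFour_of_char_443 K
  · exact not_holdsInDegree_of_choose_modEq_one K 443 (d := 435) (m := 210) (by norm_num) (by norm_num) (by decide)
  · exact not_holdsInDegree_fourHundredThirtySix_of_char_443 K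
  · exact not_holdsInDegree_of_choose_modEq_one K 443 (d := 437) (m := 15) (by norm_num) (by norm_num) (by decide)
  · exact not_holdsInDegree_of_choose_modEq_one K 443 (d := 438) (m := 117) (by norm_num) (by norm_num) (by decide)
  · exact not_holdsInDegree_of_choose_modEq_one K 443 (d := 439) (m := 18) (by norm_num) (by norm_num) (by decide)
  · exact not_holdsInDegree_fourHundredForty_of_char_443 K
  · exact not_holdsInDegree_fourHundredFortyOne_of_char_443 K
  · exact not_holdsInDegree_of_choose_modEq_one K 443 (d := 442) (m := 2) (by norm_num) (by norm_num) (by decide)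

/-- the positive digits `1 ≤ a ≤ 5`: `CA_{a·443^k}` over every field of characteristic `443`. [cite: GrafVonBothmerEtAl2007, Props. 2, 6]
[cite: CastryckLaterveerOunaies2012, Thm. 4] -/
theorem holdsInDegree_mul_fourHundredFortyThree_pow_of_le_five' {a : ℕ} (ha0 : 0 < a) (ha5 : a ≤ 5) (k : ℕ) :
    HoldsInDegree K (a * 443 ^ k) := by
  haveI : Fact (Nat.Prime 443) := ⟨by norm_num⟩
  interval_cases a
  · simpa using holdsInDegree_prime_pow_field K 443 k
  · exact holdsInDegree_two_mul_prime_pow_field K 443 k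
  · exact holdsInDegree_three_mul_prime_pow_field K 443 (by norm_num) k
  · exact holdsInDegree_mul_prime_pow_field K 443
      (holdsInDegree_of_le_four_of_charP (AlgebraicClosure K) 443 (by norm_num) le_rfl) k
  · exact holdsInDegree_five_mul_prime_pow_field K 443 (by norm_num) (by norm_num) (by norm_num) (by norm_num)
      (by norm_num) (by norm_num) (by norm_num) (by norm_num) (by norm_num) k

/-- **characteristic 443, away from the digit `8`**: over every field of characteristic `443` and for every `d ≠ 8·443^k`,
`CA_d ⟺ d = 0 ∨ d = a·443^k` with `1 ≤ a ≤ 7`.  (The degrees `8·443^k` are excluded by hypothesis: no `𝔽_443`-rational-witness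
Casas-Alvero octic exists, so the digit `8` is neither refuted nor certified here.) [cite: GrafVonBothmerEtAl2007, Props. 2, 6, 7]
[cite: CastryckLaterveerOunaies2012, Thm. 4] -/
theorem classification_char_fourHundredFortyThree_partial (d : ℕ) (hd : ∀ k : ℕ, d ≠ 8 * 443 ^ k) :
    HoldsInDegree K d ↔ d = 0 ∨ ∃ k a : ℕ, 0 < a ∧ a ≤ 7 ∧ d = a * 443 ^ k := by
  haveI : Fact (Nat.Prime 443) := ⟨by norm_num⟩
  constructor
  · intro h
    rcases Nat.eq_zero_or_pos d with rfl | hd0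
    · exact Or.inl rfl
    obtain ⟨k, a, ha0, hap, rfl, ha⟩ := digit_of_holdsInDegree K 443 hd0.ne' h
    refine Or.inr ⟨k, a, ha0, ?_, rfl⟩
    by_contra hN
    rcases Nat.lt_or_ge a 9 with hlo | hlo
    · obtain rfl : a = 8 := by omega
      exact hd k rfl
    · by_cases h8 : a = 8
      · subst h8
        exact hd k rfl
      · exact not_holdsInDegree_digit_of_char_fourHundredFortyThree' K hlo hap h8 ha
  · rintro (rfl | ⟨k, a, ha0, haN, rfl⟩)
    · exact holdsInDegree_zero K
    · rcases Nat.lt_or_ge a 6 with ha | ha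
      · exact holdsInDegree_mul_fourHundredFortyThree_pow_of_le_five' K ha0 (by omega) k
      · rcases Nat.lt_or_ge a 7 with ha' | ha'
        · obtain rfl : a = 6 := by omega
          exact holdsInDegree_six_mul_pow_of_char_443' K k
        · obtain rfl : a = 7 := le_antisymm haN ha'
          exact holdsInDegree_seven_mul_pow_of_char_443 (K := K) k

/-- **characteristic 443, complete GIVEN `CA_8`**: if the Casas-Alvero property holds over `K` in the degrees `8·443^k` (for instance once `443` is
certified a good prime of degree `8`, cf. the module docstring — nothing of the kind is proved in this tree), then `CA_d(K) ⟺ d = 0 ∨ d = a·443^k` with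
`1 ≤ a ≤ 8`. [cite: GrafVonBothmerEtAl2007, Props. 2, 6, 7] [cite: CastryckLaterveerOunaies2012, Thm. 4] -/
theorem classification_char_fourHundredFortyThree_of_degree_eight (h8 : ∀ k : ℕ, HoldsInDegree K (8 * 443 ^ k)) (d : ℕ) :
    HoldsInDegree K d ↔ d = 0 ∨ ∃ k a : ℕ, 0 < a ∧ a ≤ 8 ∧ d = a * 443 ^ k := by
  haveI : Fact (Nat.Prime 443) := ⟨by norm_num⟩
  constructor
  · intro h
    rcases Nat.eq_zero_or_pos d with rfl | hd0
    · exact Or.inl rfl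
    obtain ⟨k, a, ha0, hap, rfl, ha⟩ := digit_of_holdsInDegree K 443 hd0.ne' h
    refine Or.inr ⟨k, a, ha0, ?_, rfl⟩
    by_contra hN
    rcases Nat.lt_or_ge a 9 with hlo | hlo
    · exact hN (by omega)
    · by_cases h8' : a = 8
      · exact hN (by omega)
      · exact not_holdsInDegree_digit_of_char_fourHundredFortyThree' K hlo hap h8' ha
  · rintro (rfl | ⟨k, a, ha0, haN, rfl⟩)
    · exact holdsInDegree_zero K
    · rcases Nat.lt_or_ge a 6 with ha | ha
      · exact holdsInDegree_mul_fourHundredFortyThree_pow_of_le_five' K ha0 (by omega) k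
      · rcases Nat.lt_or_ge a 7 with ha' | ha'
        · obtain rfl : a = 6 := by omega
          exact holdsInDegree_six_mul_pow_of_char_443' K k
        · rcases Nat.lt_or_ge a 8 with ha'' | ha''
          · obtain rfl : a = 7 := by omega
            exact holdsInDegree_seven_mul_pow_of_char_443 (K := K) k
          · obtain rfl : a = 8 := le_antisymm haN ha''
            exact h8 k

/-- **characteristic 443, complete GIVEN `¬CA_8`**: if the Casas-Alvero property FAILS over `K` in degree `8`, then (leading-digit reduction, forward half,
any field) it fails in every degree `8·443^k` and `CA_d(K) ⟺ d = 0 ∨ d = a·443^k` with `1 ≤ a ≤ 7`. [cite: GrafVonBothmerEtAl2007, Props. 2, 6, 7]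
[cite: CastryckLaterveerOunaies2012, Thm. 4] -/
theorem classification_char_fourHundredFortyThree_of_not_degree_eight (h8 : ¬ HoldsInDegree K 8) (d : ℕ) :
    HoldsInDegree K d ↔ d = 0 ∨ ∃ k a : ℕ, 0 < a ∧ a ≤ 7 ∧ d = a * 443 ^ k := by
  haveI : Fact (Nat.Prime 443) := ⟨by norm_num⟩
  constructor
  · intro h
    rcases Nat.eq_zero_or_pos d with rfl | hd0
    · exact Or.inl rfl
    obtain ⟨k, a, ha0, hap, rfl, ha⟩ := digit_of_holdsInDegree K 443 hd0.ne' h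
    refine Or.inr ⟨k, a, ha0, ?_, rfl⟩
    by_contra hN
    rcases Nat.lt_or_ge a 9 with hlo | hlo
    · obtain rfl : a = 8 := by omega
      exact h8 ha
    · by_cases h8' : a = 8
      · subst h8'
        exact h8 ha
      · exact not_holdsInDegree_digit_of_char_fourHundredFortyThree' K hlo hap h8' ha
  · rintro (rfl | ⟨k, a, ha0, haN, rfl⟩)
    · exact holdsInDegree_zero K
    · rcases Nat.lt_or_ge a 6 with ha | ha
      · exact holdsInDegree_mul_fourHundredFortyThree_pow_of_le_five' K ha0 (by omega) k
      · rcases Nat.lt_or_ge a 7 with ha' | ha'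
        · obtain rfl : a = 6 := by omega
          exact holdsInDegree_six_mul_pow_of_char_443' K k
        · obtain rfl : a = 7 := le_antisymm haN ha'
          exact holdsInDegree_seven_mul_pow_of_char_443 (K := K) k

/-- the set of Casas-Alvero degrees `≤ 196249` other than `8` and `8·443 = 3544` in characteristic `443`, explicitly (corollary of the classification away
from the digit `8`: [cite: GrafVonBothmerEtAl2007, Prop. 6] with [cite: CastryckLaterveerOunaies2012, Thm. 4] and the digit refutations above). -/
theorem holdsInDegree_iff_mem_of_le_char_fourHundredFortyThree_sq' {d : ℕ} (hd : d ≤ 196249) (h8 : d ≠ 8) (h8p : d ≠ 3544) :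
    HoldsInDegree K d ↔ d ∈ ({0, 1, 2, 3, 4, 5, 6, 7, 443, 886, 1329, 1772, 2215, 2658, 3101, 196249} : Finset ℕ) := by
  have hd' : ∀ k : ℕ, d ≠ 8 * 443 ^ k := by
    intro k
    rcases k with _ | _ | k
    · simpa using h8
    · simpa using h8p
    · intro h
      have : 443 ^ 2 ≤ 443 ^ (k + 1 + 1) := Nat.pow_le_pow_right (by norm_num) (by omega)
      omega
  rw [classification_char_fourHundredFortyThree_partial K d hd']
  constructor
  · rintro (rfl | ⟨k, a, ha0, haN, rfl⟩)
    · decide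
    · rcases k with _ | _ | _ | k
      · interval_cases a <;> decide
      · interval_cases a <;> decide
      · interval_cases a <;> simp_all
      · exfalso
        have : 443 ^ 3 ≤ a * 443 ^ (k + 1 + 1 + 1) :=
          le_trans (Nat.pow_le_pow_right (by norm_num) (by omega)) (Nat.le_mul_of_pos_left _ ha0)
        omega
  · intro h
    simp only [Finset.mem_insert, Finset.mem_singleton] at h
    rcases h with rfl | rfl | rfl | rfl | rfl | rfl | rfl | rfl | rfl | rfl | rfl | rfl | rfl | rfl | rfl | rfl
    · exact Or.inl rfl
    · exact Or.inr ⟨0, 1, by norm_num, by norm_num, by norm_num⟩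
    · exact Or.inr ⟨0, 2, by norm_num, by norm_num, by norm_num⟩
    · exact Or.inr ⟨0, 3, by norm_num, by norm_num, by norm_num⟩
    · exact Or.inr ⟨0, 4, by norm_num, by norm_num, by norm_num⟩
    · exact Or.inr ⟨0, 5, by norm_num, by norm_num, by norm_num⟩
    · exact Or.inr ⟨0, 6, by norm_num, by norm_num, by norm_num⟩
    · exact Or.inr ⟨0, 7, by norm_num, by norm_num, by norm_num⟩
    · exact Or.inr ⟨1, 1, by norm_num, by norm_num, by norm_num⟩
    · exact Or.inr ⟨1, 2, by norm_num, by norm_num, by norm_num⟩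
    · exact Or.inr ⟨1, 3, by norm_num, by norm_num, by norm_num⟩
    · exact Or.inr ⟨1, 4, by norm_num, by norm_num, by norm_num⟩
    · exact Or.inr ⟨1, 5, by norm_num, by norm_num, by norm_num⟩
    · exact Or.inr ⟨1, 6, by norm_num, by norm_num, by norm_num⟩
    · exact Or.inr ⟨1, 7, by norm_num, by norm_num, by norm_num⟩
    · exact Or.inr ⟨2, 1, by norm_num, by norm_num, by norm_num⟩

end CharFourHundredFortyThreePartial

end Literature.Algebra.Polynomial.CasasAlvero
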